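import Summits.CriticalPhenomena.PercolationContinuityZ3.Theorems.PercNearOneGluingNoHeavyLowerTailSahiTransportJRData4

/-!
# `NoHeavyLowerTail` (crux stmt-CriticalPhenomena-4575), Sahi / Kahn positivity: parameter-free transport certificates on `2^4` — evaluation C

Support file (cell `prim-l12`, seat P3, gen 5; `--supports stmt-CriticalPhenomena-4575`).  Computational (`native_decide`): the digit test
`SahiTransportJR.checkTab 33 4 M (certTab4 M)` — structure of the table, every capacity row and all `14 196` transport rows `X ≤ Z` over the `168`
increasing bitmasks of `2^4`, each a `256`-digit base-`2^33` Kronecker-number test — passes for the 28 nontrivial increasing pattern events `M` of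
batch C (`batch4C`).  Six batches A–F cover the `163` events of `2^4` outside the `K₂,₂` orbit; with `…SahiTransportJRSound.sahiE_three_nonneg_of_checkTab`
each gives Kahn's Conjecture 5 / Sahi's `C₃` for that junta first slot, the other two increasing events arbitrary, every dimension. [this work]
-/

namespace Summit.CriticalPhenomena.PercolationContinuityZ3.Theorems.SahiTransportJR

/-- Batch C of certified pattern events of `2^4` (bitmasks over the `16` points). [this work] -/
def batch4C : List ℕ := [60136, 60138, 60416, 60544, 60552, 60576, 60584, 60608, 60616, 60620, 60640, 60648, 60652, 60928, 61056, 61064, 61088, 61096, 61098, 61120, 61128, 61132, 61160, 61162, 61164, 61166, 61440, 61568]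

/-- Every event of batch C passes the certificate check (kernel evaluation via `native_decide`). [this work] -/
theorem checkTab4_batchC : (batch4C.all fun M => checkTab 33 4 M (certTab4 M)) = true := by native_decide

/-- Pointwise form. [this work] -/
theorem checkTab4_of_mem_batchC {M : ℕ} (h : M ∈ batch4C) : checkTab 33 4 M (certTab4 M) = true :=
  List.all_eq_true.1 checkTab4_batchC M h

end Summit.CriticalPhenomena.PercolationContinuityZ3.Theorems.SahiTransportJR
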